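import Literature.AlgebraicGeometry.Resolution.CanonicalResolution
import Literature.AlgebraicGeometry.Resolution.MarkedResolutions
import Literature.AlgebraicGeometry.Resolution.RegularBlowup
import Literature.AlgebraicGeometry.Resolution.Temkin2008Localization
import HarnessLib

/-!
# The canonical resolution of `(X, 𝓘_Z, E, 1)` for a smooth centre `Z`: base cases of BGMW Thm. 4.0.6 / 8.0.5

Topic: `Literature/AlgebraicGeometry/Resolution`. Bottom layer of the decomposition of the named
fact `BierstoneGrigorievMilmanWlodarczyk2011_canonical` (`CanonicalResolution.lean`; Bierstone–
Grigoriev–Milman–Włodarczyk, *Effective Hironaka resolution and its complexity (with appendix on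
applications in positive characteristic)*, arXiv:1206.3090, Thm. 8.0.5 with Lemma 8.0.3 (1) and
Cor. 8.0.6–8.0.7 for the marked ideal `(𝔸ⁿ_k, (S), ∅, 1)`). That fact is the canonical
resolution ALGORITHM of marked ideals (§4, proof of Thm. 4.0.6, run in characteristic
`p > M̄`, §8) and is of size XL; this file PROVES, over Mathlib and the tree, the two terminal
cases of the algorithm and the non-vacuity of the admissibility conditions of Def. 3.1.3 at a
smooth centre — the bricks every run of the algorithm ends with:

* proof of Thm. 4.0.6, first sentence: "If `𝓘 = 0` and `μ > 0` then `supp(X, 𝓘, μ) = X`, and the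
  blow-up of `X` is the empty set and thus it defines a unique resolution"
  (`CentreSeq.single_bot_isResolutionOf`, with `IsBlowup.isEmpty_of_bot` of
  `Temkin2008Localization.lean`);
* Step 1b ⇒ Step 2a for `(X, 𝓘_Z, E, 1)` with `Z` a smooth centre having simple normal crossings
  with `E`: the single blow-up of `Z` is a resolution — `𝓘₁ = 𝓘(D)⁻¹ σ^*(𝓘_Z) = 𝒪_{X₁}`,
  `supp(𝓘₁, 1) = ∅` ("In the second case we get a resolution", Step 2a, p. 13)
  (`CentreSeq.single_isResolutionOf`, the data-level form of `isMarkedResolution_blowup_centre`);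
* Def. 3.1.3 (1)–(2) are MET by a smooth centre in a smooth ambient variety with empty
  boundary: for `X` regular and locally Noetherian and `V(C)` a regular scheme, `HasSNCWith [] C`
  (`hasSNCWith_nil_of_isRegular`) — at each point `x ∈ V(C)` the stalk `C_x` is generated by part
  of a regular system of parameters of `𝒪_{X,x}` (`exists_rsop_of_isRegularLocalRing_quotient`,
  Matsumura Thm. 14.2: for a regular local ring `R` and `J ⊆ 𝔪` with `R/J` regular, `J` is
  generated by members of a minimal basis of `𝔪`); this is the first non-vacuous instance of
  `HasSNCWith` (`MarkedIdeals.lean`) in the tree;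
* consequently the conclusion (i) ∧ (ii) of `BierstoneGrigorievMilmanWlodarczyk2011_canonical`
  HOLDS, in every characteristic and with `s = single 𝓘_Y`, whenever `Y = V(S) ⊆ 𝔸ⁿ_k` is itself
  regular (`bierstoneGrigorievMilmanWlodarczyk2011_canonical_of_isRegular`): this is the
  identification "the canonical resolution of `(U, 𝓘_Z, ∅, 1)`, `Z` smooth, is the blow-up of `Z`"
  used in clause (ii) of the fact (proof of Thm. 4.0.6 for `(𝓘_Z, 1)`: `𝒩(𝓘_Z) = 𝓘_Z` of maximal
  order `1 = μ`, `O(𝓘_Z, 1) = 𝒞(ℋ(𝓘_Z, 1)) = (𝓘_Z, 1)`, Step 1b down to `Z`, where the restricted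
  ideal is `0` and the whole of `Z` is blown up), at the level of its OUTPUT.

## Sources

* E. Bierstone, D. Grigoriev, P. Milman, J. Włodarczyk, arXiv:1206.3090 (arXiv numbering):
  Def. 3.1.3 (p. 6), §4 proof of Thm. 4.0.6, first paragraph and Steps 1b, 2a (pp. 11–13),
  Thm. 8.0.5, Cor. 8.0.6 (p. 23). [BierstoneGrigorievMilmanWlodarczyk2011]
* H. Matsumura, *Commutative Ring Theory*, CUP 1986, Thm. 14.2. [Matsumura1987]
* Q. Liu, *Algebraic Geometry and Arithmetic Curves*, OUP 2002, Thm. 8.1.19 (a). [Liu2002]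
-/

noncomputable section

open CategoryTheory CategoryTheory.Limits AlgebraicGeometry TopologicalSpace Topology IsLocalRing

namespace Literature.AlgebraicGeometry.Resolution

universe u

/-! ## Matsumura Thm. 14.2: the ideal of a regular quotient is generated by part of a regular system of parameters -/

/-- **The ideal of a regular quotient of a regular local ring is generated by part of a regular
system of parameters** (Matsumura, Thm. 14.2, the direction (1) ⇒ used by BGMW Def. 3.1.3 (2)):
for a regular local ring `(R, 𝔪)` and an ideal `J ⊆ 𝔪` with `R/J` regular there is a minimal
basis `u_1, …, u_d` of `𝔪` (`d = emb dim R`) and a set `S` of indices with `J = (u_i : i ∈ S)`.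
Proof: `J` is generated by `f_1, …, f_c ∈ J` with `df_i` linearly independent in `𝔪/𝔪²`
(`exists_span_eq_of_isRegularLocalRing_quotient`); extend the `df_i` to a basis of `𝔪/𝔪²` and
lift the new vectors; by Nakayama the lifts together with the `f_i` generate `𝔪`.
[cite: Matsumura1987, Thm. 14.2] -/
theorem exists_rsop_of_isRegularLocalRing_quotient {R : Type u} [CommRing R] [IsRegularLocalRing R]
    {J : Ideal R} (hJ : J ≤ maximalIdeal R) [IsRegularLocalRing (R ⧸ J)] :
    ∃ u : Fin (maximalIdeal R).spanFinrank → R, Ideal.span (Set.range u) = maximalIdeal R ∧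
      ∃ S : Set (Fin (maximalIdeal R).spanFinrank), J = Ideal.span (u '' S) := by
  classical
  obtain ⟨c, f, hfG, hspan, hli⟩ :=
    exists_span_eq_of_isRegularLocalRing_quotient hJ (J : Set R) (Ideal.span_eq J)
  set m := maximalIdeal R with hm
  have hf : ∀ i, f i ∈ m := fun i => hJ (hfG i)
  -- the differentials `v i = df_i`, linearly independent
  let v : Fin c → CotangentSpace R := fun i => m.toCotangent ⟨f i, hf i⟩
  have hliv : LinearIndependent (ResidueField R) v := hli
  have hvinj : Function.Injective v := hliv.injective
  set V : Set (CotangentSpace R) := Set.range v with hV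
  have hliV : LinearIndepOn (ResidueField R) id V := hliv.linearIndepOn_id
  -- extend to a basis `T ⊇ V` of the cotangent space
  set T : Set (CotangentSpace R) := hliV.extend (Set.subset_univ _) with hT
  let b : Module.Basis T (ResidueField R) (CotangentSpace R) := Module.Basis.extend hliV
  have hVT : V ⊆ T := hliV.subset_extend _
  have hTfin : T.Finite := Set.finite_coe_iff.mp (Module.Finite.finite_basis b)
  haveI : Finite T := hTfin.to_subtype
  have hspanT : Submodule.span (ResidueField R) T = ⊤ := by
    rw [← b.span_eq, Module.Basis.range_extend]
  have hcardT : Nat.card T = m.spanFinrank := by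
    rw [IsLocalRing.spanFinrank_maximalIdeal_eq_finrank_cotangentSpace R,
      Module.finrank_eq_nat_card_basis b]
  -- enumerate `T` by `Fin d`
  let e : Fin m.spanFinrank ≃ T := (Finite.equivFinOfCardEq hcardT).symm
  -- lift: `f_j` over `df_j`, any lift elsewhere
  let σ : CotangentSpace R → m := Function.surjInv m.toCotangent_surjective
  have hσ : ∀ w, m.toCotangent (σ w) = w := Function.surjInv_eq m.toCotangent_surjective
  let L : CotangentSpace R → R := fun w => if h : ∃ j, v j = w then f h.choose else (σ w : R)
  have hLm : ∀ w, L w ∈ m := by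
    intro w
    by_cases h : ∃ j, v j = w
    · simp only [L, dif_pos h]
      exact hf _
    · simp only [L, dif_neg h]
      exact (σ w).2
  have hLv : ∀ j, L (v j) = f j := by
    intro j
    have h : ∃ j', v j' = v j := ⟨j, rfl⟩
    simp only [L, dif_pos h]
    exact congrArg f (hvinj h.choose_spec)
  have hLcot : ∀ w, m.toCotangent ⟨L w, hLm w⟩ = w := by
    intro w
    by_cases h : ∃ j, v j = w
    · obtain ⟨j, rfl⟩ := h
      have : (⟨L (v j), hLm (v j)⟩ : m) = ⟨f j, hf j⟩ := Subtype.ext (hLv j)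
      rw [this]
    · have : (⟨L w, hLm w⟩ : m) = σ w := Subtype.ext (by simp only [L, dif_neg h])
      rw [this, hσ]
  let u : Fin m.spanFinrank → R := fun i => L (e i)
  refine ⟨u, ?_, {i | ((e i : T) : CotangentSpace R) ∈ V}, ?_⟩
  · -- Nakayama: the `u i` generate `𝔪`, their differentials being the basis `T`
    let g : Fin m.spanFinrank → m := fun i => ⟨u i, hLm _⟩
    have hrange : Set.range (m.toCotangent ∘ g) = T := by
      ext w
      simp only [Set.mem_range, Function.comp_apply, g, u, hLcot]
      constructor
      · rintro ⟨i, rfl⟩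
        exact (e i).2
      · intro hw
        exact ⟨e.symm ⟨w, hw⟩, by simp⟩
    have key : Submodule.span R (Set.range g) = ⊤ := by
      rw [← CotangentSpace.span_image_eq_top_iff, ← Set.range_comp, hrange, hspanT]
    have h1 : Set.range u = m.subtype '' Set.range g := by
      ext x
      simp only [Set.mem_range, Set.mem_image, Submodule.coe_subtype, g]
      constructor
      · rintro ⟨i, rfl⟩
        exact ⟨⟨u i, hLm _⟩, ⟨i, rfl⟩, rfl⟩
      · rintro ⟨_, ⟨i, rfl⟩, rfl⟩
        exact ⟨i, rfl⟩
    rw [h1, Ideal.span, Submodule.span_image, key, Submodule.map_top, Submodule.range_subtype]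
  · -- `J = (f) = (u_i : du_i ∈ V)`
    have himg : u '' {i | ((e i : T) : CotangentSpace R) ∈ V} = Set.range f := by
      ext x
      simp only [Set.mem_image, Set.mem_setOf_eq, Set.mem_range, u]
      constructor
      · rintro ⟨i, ⟨j, hj⟩, rfl⟩
        exact ⟨j, by rw [← hj, hLv]⟩
      · rintro ⟨j, rfl⟩
        refine ⟨e.symm ⟨v j, hVT ⟨j, rfl⟩⟩, ?_, ?_⟩
        · simp only [Equiv.apply_symm_apply]
          exact ⟨j, rfl⟩
        · simp only [Equiv.apply_symm_apply, hLv]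
    rw [himg, hspan]

/-! ## A smooth centre in a smooth ambient scheme is admissible (BGMW Def. 3.1.3 (2) with `E = ∅`) -/

/-- **The stalk of the structure sheaf modulo the stalk of the ideal of a regular closed
subscheme is a regular local ring**: for `X` locally Noetherian, `V(C)` regular and
`x ∈ V(C)`, `𝒪_{X,x} / C_x` is regular (it is the local ring of `V(C)` at `x`: on an affine
open `W = Spec A ∋ x`, `A / C(W)` is a regular ring and `𝒪_{X,x}/C_x = A_𝔭 / C(W) A_𝔭`).
[folklore] -/
theorem isRegularLocalRing_stalk_quotient_stalkIdeal {X : Scheme.{u}} [IsLocallyNoetherian X]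
    {C : X.IdealSheafData} (hC : Scheme.IsRegular C.subscheme) {x : X} (hx : x ∈ C.support) :
    IsRegularLocalRing (X.presheaf.stalk x ⧸ stalkIdeal C x) := by
  obtain ⟨W, hW, hxW, -⟩ := exists_isAffineOpen_mem_and_subset (X := X) (x := x) (U := ⊤)
    (Opens.mem_top _)
  haveI : IsNoetherianRing Γ(X, W) := IsLocallyNoetherian.component_noetherian ⟨W, hW⟩
  set I : Ideal Γ(X, W) := C.ideal ⟨W, hW⟩ with hI
  -- `Γ(W)/C(W)` is a regular ring: `Spec` of it is an open of the regular scheme `V(C)`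
  haveI : IsRegularRing (Γ(X, W) ⧸ I) := by
    have hreg : Scheme.IsRegular (Spec (C.subschemeCover.X ⟨W, hW⟩)) :=
      Scheme.IsRegular.of_isOpenImmersion (C.subschemeCover.f ⟨W, hW⟩) hC
    exact (Scheme.isRegular_Spec_iff (.of (Γ(X, W) ⧸ I))).mp hreg
  -- the prime `𝔭` of `x` contains `C(W)`
  set p := hW.primeIdealOf ⟨x, hxW⟩ with hp
  have hmemD : ∀ g : Γ(X, W), x ∈ X.basicOpen g ↔ g ∉ p.asIdeal := by
    intro g
    rw [← PrimeSpectrum.mem_basicOpen, ← hW.fromSpec_preimage_basicOpen g]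
    change _ ↔ hW.fromSpec (hW.primeIdealOf ⟨x, hxW⟩) ∈ X.basicOpen g
    rw [hW.fromSpec_primeIdealOf ⟨x, hxW⟩]
  have hIp : I ≤ p.asIdeal := by
    intro f hf
    have hz := (Scheme.IdealSheafData.mem_support_iff_of_mem (I := C) (U := ⟨W, hW⟩) hxW).mp hx
    rw [Scheme.mem_zeroLocus_iff] at hz
    by_contra hfp
    exact hz f hf ((hmemD f).mpr hfp)
  have hq := isRegularLocalRing_localization_quotient_of_le I p.asIdeal hIp
  -- transport from `A_𝔭` to the stalk
  letI : Algebra Γ(X, W) (X.presheaf.stalk x) :=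
    TopCat.Presheaf.algebra_section_stalk X.presheaf ⟨x, hxW⟩
  haveI : IsLocalization.AtPrime (X.presheaf.stalk x) p.asIdeal := hW.isLocalization_stalk ⟨x, hxW⟩
  let e : Localization.AtPrime p.asIdeal ≃ₐ[Γ(X, W)] X.presheaf.stalk x :=
    IsLocalization.algEquiv p.asIdeal.primeCompl _ _
  have hst : stalkIdeal C x = I.map (algebraMap Γ(X, W) (X.presheaf.stalk x)) :=
    stalkIdeal_eq_map_germ C ⟨W, hW⟩ hxW
  have hmap : stalkIdeal C x =
      (I.map (algebraMap Γ(X, W) (Localization.AtPrime p.asIdeal))).map (e : _ →+* _) := by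
    rw [hst, Ideal.map_map]
    congr 1
    exact (e.toAlgHom.comp_algebraMap).symm
  exact IsRegularLocalRing.of_ringEquiv (Ideal.quotientEquiv _ _ e.toRingEquiv hmap)

/-- **A smooth centre in a smooth ambient scheme with empty boundary is admissible** (the
conditions of BGMW Def. 3.1.1 / Def. 3.1.3 (2) are met, `HasSNCWith [] C`): if `X` is regular
and locally Noetherian and `V(C)` is a regular scheme, then at every point `𝒪_{X,x}` is regular
and, for `x ∈ V(C)`, `C_x` is generated by part of a regular system of parameters (Matsumura
Thm. 14.2, `exists_rsop_of_isRegularLocalRing_quotient`). Non-vacuity of `HasSNCWith`.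
[cite: BierstoneGrigorievMilmanWlodarczyk2011, Def. 3.1.3 (2)] -/
theorem hasSNCWith_nil_of_isRegular {X : Scheme.{u}} [IsLocallyNoetherian X]
    (hX : Scheme.IsRegular X) {C : X.IdealSheafData} (hC : Scheme.IsRegular C.subscheme) :
    HasSNCWith [] C := by
  intro x
  haveI := hX x
  refine ⟨hX x, ?_⟩
  by_cases hx : x ∈ C.support
  · haveI := isRegularLocalRing_stalk_quotient_stalkIdeal hC hx
    have hJ : stalkIdeal C x ≤ maximalIdeal _ := (mem_support_iff_stalkIdeal_le C x).mp hx
    obtain ⟨u, hu, S, hS⟩ := exists_rsop_of_isRegularLocalRing_quotient hJ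
    exact ⟨u, hu, ⟨fun D => absurd D.2.1 (by simp), fun D => absurd D.2.1 (by simp),
      fun D => absurd D.2.1 (by simp)⟩, fun _ => ⟨S, hS⟩⟩
  · obtain ⟨u, hu⟩ := exists_regularSystemOfParameters (R := X.presheaf.stalk x)
    exact ⟨u, hu, ⟨fun D => absurd D.2.1 (by simp), fun D => absurd D.2.1 (by simp),
      fun D => absurd D.2.1 (by simp)⟩, fun h => (hx h).elim⟩

/-- The boundary conditions of `HasSNCWith E C` do not involve `C`: simple normal crossings of
`E` (`HasSNC E = HasSNCWith E ⊤`) give `HasSNCWith E ⊥` (the centre `V(0) = X`, whose stalks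
`0 = (u_i : i ∈ ∅)` are generated by the empty part of any system of parameters). [folklore] -/
theorem HasSNC.hasSNCWith_bot {X : Scheme.{u}} {E : List X.IdealSheafData} (h : HasSNC E) :
    HasSNCWith E ⊥ := by
  intro x
  obtain ⟨hreg, u, hu, hE, -⟩ := h x
  refine ⟨hreg, u, hu, hE, fun _ => ⟨∅, ?_⟩⟩
  obtain ⟨U, hU, hxU, -⟩ := exists_isAffineOpen_mem_and_subset (X := X) (x := x) (U := ⊤)
    (Opens.mem_top _)
  rw [stalkIdeal_eq_map_germ ⊥ ⟨U, hU⟩ hxU, Scheme.IdealSheafData.ideal_bot, Pi.bot_apply,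
    Ideal.map_bot, Set.image_empty, Ideal.span_empty]

/-! ## The two terminal cases of the algorithm (BGMW §4, proof of Thm. 4.0.6) -/

/-- The stalks of the zero ideal sheaf vanish. [folklore] -/
theorem stalkIdeal_bot {X : Scheme.{u}} (x : X) : stalkIdeal (⊥ : X.IdealSheafData) x = ⊥ := by
  obtain ⟨U, hU, hxU, -⟩ := exists_isAffineOpen_mem_and_subset (X := X) (x := x) (U := ⊤)
    (Opens.mem_top _)
  rw [stalkIdeal_eq_map_germ ⊥ ⟨U, hU⟩ hxU, Scheme.IdealSheafData.ideal_bot, Pi.bot_apply,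
    Ideal.map_bot]

namespace CentreSeq

variable {X : Scheme.{u}}

/-- **Case `𝓘 = 0` of BGMW Thm. 4.0.6** ("If `𝓘 = 0` and `μ > 0` then `supp(X, 𝓘, μ) = X`, and
the blow-up of `X` is the empty set and thus it defines a unique resolution"): on a regular
scheme with simple normal crossings boundary `E`, the one-step sequence blowing up the zero
ideal (centre `V(0) = X`) is a resolution of `(X, 0, E, μ)`, `μ ≥ 1` — indeed for every `μ`.
[cite: BierstoneGrigorievMilmanWlodarczyk2011, §4 proof of Thm. 4.0.6 (case 𝓘 = 0)] -/
theorem single_bot_isResolutionOf (hX : Scheme.IsRegular X) {E : List X.IdealSheafData}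
    (hE : HasSNC E) (μ : ℕ) : (single (⊥ : X.IdealSheafData)).IsResolutionOf ⟨⊥, E, μ⟩ := by
  refine ⟨⟨?_, hE.hasSNCWith_bot, ?_, trivial⟩, ?_⟩
  · intro x _
    rw [MarkedIdeal.mem_support_iff]
    change stalkIdeal (⊥ : X.IdealSheafData) x ≤ _
    rw [stalkIdeal_bot]
    exact bot_le
  · exact Scheme.IsRegular.of_isOpenImmersion (Scheme.IdealSheafData.subschemeι ⊥) hX
  · haveI := (blowup.isBlowup (⊥ : X.IdealSheafData)).isEmpty_of_bot
    change (MarkedIdeal.transform (blowup.π (⊥ : X.IdealSheafData)) ⊥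
      (⟨⊥, E, μ⟩ : MarkedIdeal X)).support = ∅
    exact Set.eq_empty_iff_forall_notMem.mpr fun y _ => isEmptyElim y

/-- **Blowing up a smooth centre `C` having simple normal crossings with `E` resolves
`(X, 𝓘_C, E, 1)` in one step**, data-level form (`CentreSeq.single`, `IsResolutionOf`) of
`isMarkedResolution_blowup_centre`: the transform is `(Bl_C X, 𝒪, σᶜ(E) ∪ {D}, 1)` of empty
support (BGMW §4, Step 1b for `(𝓘_C, 1)` ending in Step 2a's "In the second case we get a
resolution"). [cite: BierstoneGrigorievMilmanWlodarczyk2011, Def. 3.1.3 and §4 Step 2a] -/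
theorem single_isResolutionOf {C : X.IdealSheafData} {E : List X.IdealSheafData}
    (hsnc : HasSNCWith E C) (hC : Scheme.IsRegular C.subscheme) :
    (single C).IsResolutionOf ⟨C, E, 1⟩ := by
  refine ⟨⟨?_, hsnc, hC, trivial⟩, ?_⟩
  · rw [MarkedIdeal.support_of_mult_eq_one _ rfl]
  · change (MarkedIdeal.transform (blowup.π C) C ⟨C, E, 1⟩).support = ∅
    rw [MarkedIdeal.support_of_mult_eq_one _ rfl, MarkedIdeal.transform_ideal]
    change ((controlledTransform (blowup.π C) C C 1).support : Set (blowup C)) = ∅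
    rw [controlledTransform_self_one, Scheme.IdealSheafData.support_top]
    rfl

/-- The chosen blow-up of a regular locally Noetherian scheme along a regular centre is regular
(Liu, Thm. 8.1.19 (a), `IsBlowup.isRegular_of_isRegular_subscheme`): regularity of the ambient
scheme persists along the one-step sequence. [cite: Liu2002, Thm. 8.1.19 (a)] -/
theorem isRegular_top_single [IsLocallyNoetherian X] (hX : Scheme.IsRegular X)
    {C : X.IdealSheafData} (hC : Scheme.IsRegular C.subscheme) :
    Scheme.IsRegular (single C).top :=
  IsBlowup.isRegular_of_isRegular_subscheme hX hC (blowup.isBlowup C)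

end CentreSeq

/-! ## The fact `BierstoneGrigorievMilmanWlodarczyk2011_canonical` for smooth `Y = V(S)` -/

/-- The closed subscheme `V(𝓘_Y)` cut out by the ideal sheaf of the closed immersion
`ι : V(S) ↪ 𝔸ⁿ_k` is regular when `V(S)` is (`ι` induces `V(S) ≅ V(ker ι)`). [folklore] -/
theorem isRegular_subscheme_ker_affineZeroLocusι (k : Type) [Field k] (n : ℕ)
    (S : Finset (MvPolynomial (Fin n) k)) (hY : Scheme.IsRegular (affineZeroLocus k n S)) :
    Scheme.IsRegular (affineZeroLocusι k n S).ker.subscheme :=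
  Scheme.IsRegular.of_iso (affineZeroLocusι k n S).toImage hY

/-- **BGMW Thm. 8.0.5 / Cor. 8.0.6 for `(𝔸ⁿ_k, 𝓘_Y, ∅, 1)` with `Y = V(S)` SMOOTH — the
conclusion of `BierstoneGrigorievMilmanWlodarczyk2011_canonical` holds with the one-step
sequence blowing up `Y`, in every characteristic**: (i) `single 𝓘_Y` is a resolution of the
marked ideal `(𝔸ⁿ_k, 𝓘_Y, ∅, 1)` (admissible by `hasSNCWith_nil_of_isRegular`, resolving by
`CentreSeq.single_isResolutionOf`), and (ii) its restriction to any open `U` is the one-step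
sequence along `𝓘_Y|U`, in particular an extension of it. This is the canonical resolution of
the proof of Thm. 4.0.6 for `(𝓘_Z, 1)`, `Z` smooth (`𝒩(𝓘_Z) = 𝓘_Z` of maximal order `1 = μ`,
`O(𝓘_Z, 1) = 𝒞(ℋ(𝓘_Z, 1)) = (𝓘_Z, 1)`, Step 1b restricts to hypersurfaces of maximal contact
down to `Z`, where the ideal vanishes and all of `Z` is blown up; then `𝓘₁ = 𝒪`), read at the
level of its output. [cite: BierstoneGrigorievMilmanWlodarczyk2011, Thm. 8.0.5 with §4 proof of Thm. 4.0.6 (Steps 1b, 2a) and Cor. 8.0.6] -/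
theorem bierstoneGrigorievMilmanWlodarczyk2011_canonical_of_isRegular (k : Type) [Field k] (n : ℕ)
    (S : Finset (MvPolynomial (Fin n) k)) (hY : Scheme.IsRegular (affineZeroLocus k n S)) :
    (CentreSeq.single (affineZeroLocusι k n S).ker).IsResolutionOf
        ⟨(affineZeroLocusι k n S).ker, [], 1⟩ ∧
      ∀ (U : Scheme.{0}) (j : U ⟶ Spec (CommRingCat.of (MvPolynomial (Fin n) k)))
        [IsOpenImmersion j],
        ((CentreSeq.single (affineZeroLocusι k n S).ker).restrict j).IsExtensionOfSingle
          ((affineZeroLocusι k n S).ker.comap j) := by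
  have hC := isRegular_subscheme_ker_affineZeroLocusι k n S hY
  refine ⟨CentreSeq.single_isResolutionOf
    (hasSNCWith_nil_of_isRegular (Scheme.isRegular_Spec _) hC) hC, fun U j _ => ?_⟩
  rw [CentreSeq.restrict_single]
  exact CentreSeq.isExtensionOfSingle_single _

/-- **The inner statement of `BierstoneGrigorievMilmanWlodarczyk2011_canonical` for smooth
`Y = V(S)`**, in every characteristic and without any bound: the shape
`∃ s, s.IsResolutionOf (𝔸ⁿ_k, 𝓘_Y, ∅, 1) ∧ (Y integral → ∀ U ↪ 𝔸ⁿ open meeting Y inside Reg Y,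
s|U extends the blow-up of 𝓘_Y|U)` quantified in the named fact, witnessed by `s = single 𝓘_Y`
(`bierstoneGrigorievMilmanWlodarczyk2011_canonical_of_isRegular`). The smooth case of BGMW
Cor. 8.0.6; the general case is the resolution algorithm of Thm. 8.0.5.
[cite: BierstoneGrigorievMilmanWlodarczyk2011, Cor. 8.0.6 with Thm. 8.0.5 (smooth case)] -/
theorem bierstoneGrigorievMilmanWlodarczyk2011_canonical_inner_of_isRegular (k : Type) [Field k]
    (n : ℕ) (S : Finset (MvPolynomial (Fin n) k)) (hY : Scheme.IsRegular (affineZeroLocus k n S)) :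
    ∃ s : CentreSeq (Spec (CommRingCat.of (MvPolynomial (Fin n) k))),
      s.IsResolutionOf ⟨(affineZeroLocusι k n S).ker, [], 1⟩ ∧
      (IsIntegral (affineZeroLocus k n S) →
        ∀ (U : Scheme.{0}) (j : U ⟶ Spec (CommRingCat.of (MvPolynomial (Fin n) k)))
          [IsOpenImmersion j],
          (∃ y : affineZeroLocus k n S, affineZeroLocusι k n S y ∈ Set.range j) →
          (∀ y : affineZeroLocus k n S, affineZeroLocusι k n S y ∈ Set.range j →
            IsRegularLocalRing ((affineZeroLocus k n S).presheaf.stalk y)) →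
            (s.restrict j).IsExtensionOfSingle ((affineZeroLocusι k n S).ker.comap j)) :=
  ⟨_, (bierstoneGrigorievMilmanWlodarczyk2011_canonical_of_isRegular k n S hY).1,
    fun _ U j _ _ _ => (bierstoneGrigorievMilmanWlodarczyk2011_canonical_of_isRegular k n S hY).2 U j⟩

end Literature.AlgebraicGeometry.Resolution

end
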